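import Literature.MathematicalPhysics.QuantumFieldTheory.Balaban1983to89.B9Ineq363Vprime
import Literature.MathematicalPhysics.QuantumFieldTheory.Balaban1983to89.B9Ineq347AllEntries

/-!
# `Balaban1983to89.B9Ineq347GpExt` — B9 p. 403 «we can prove all the statements (3.42)–(3.47) of Theorem 3.1 for the
# operator G′(U′U)»: the GLOBAL weighted inequalities (3.47)₁ and (3.47)₃ FOR THE CONCRETE `G′(U′U)` of (3.64) with the
# CONCRETE `V′(A)` of (3.60), from the (3.42)₁,₃ majorants of `B9Ineq363Vprime.thm34_Gp_entries13_vPrime` by the printed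
# route «(3.47) are consequences of the local ones (3.42) and Lemma 2.1» (`B9Ineq347AllEntries.glob347_of_342_weighted`)

statement-level skeleton of published theorems with citation tags; proofs where landed; nothing here is a claim about the Yang–Mills mass gap

CITATION HEADER (lean-in-tree rule).  T. Bałaban, *Propagators for lattice gauge theories in a background field*, Commun.
Math. Phys. **99** (1985) 389–434 [Balaban1985BackgroundPropagators] (cell paper B9; held `paper:balaban1985-cmp99-
background-propagators`, journal page = PDF page + 388).  PDF held: p. 403 [PDF 15] read on the render `b2b-balaban-ref1/
pages/…-p015-x2.png` (2026-08-21), p. 398 [PDF 10] on `…-p010-x2.png`.  THE PRINT (verbatim).  p. 403: «Now applying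
Theorem 3.1 for G′(U), the bound (3.63), the representation (3.64) and Lemma 2.1 of [4] we can prove all the statements
(3.42)–(3.47) of Theorem 3.1 for the operator G′(U′U), of course with different constants, although changes are small. We
define new constants in such a way that the statements of Theorem 3.1 hold for extended operators.»  p. 398: «and the
global inequalities |G′(U)λ|_{(2+γ)}, |∇_UG′(U)λ|_{(1+γ)}, |G′(U)∇\*_Uλ|_{(1+γ)}, |∇_UG′(U)λ|_{(γ)} ≦ B₀|λ|_{(γ)} (3.47) for γ in
a fixed compact subset of real numbers, e.g. for γ ∈ [−4, 4].» and «It is easy to see that the global inequalities (3.47)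
are consequences of the local ones (3.42) and Lemma 2.1.»  [4] = T. Bałaban, *Propagators and renormalization
transformations for lattice gauge theories. II*, Commun. Math. Phys. **96** (1984) 223–250 [Balaban1984PropagatorsII],
Lemma 2.1 p. 234 ((2.60), (2.61)).  Cell `lit-balaban`, seat r06 (B9 fold owner) gen 10; SKELETON rows **B9.Eq3.62** ((3.64):
«we can prove … (3.42)–(3.47) … for G′(U′U)») × **B9.Thm3.4** (G′-clause) × B9.Thm3.1 ((3.47)); pointer by seat p27 gen 7
(HOME `lit-balaban-r06/INBOX.md` 18:58Z: «(3.47)₁,₃ for the CONCRETE G′(U′U) = `glob347_of_342_weighted` applied to the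
majorants of `thm34_Gp_entries13_vPrime` (δ₀ := (1−α′)ρ resp. (1−3α′)ρ, P := len² resp. len)»).

SIBLINGS REUSED BY NAME (imported; nothing restated): `B9Ineq363Vprime.thm34_Gp_entries13_vPrime` (r06 gen 9: existence of
`G′(U′U) := gPrimeExtEnd G′ (V′G′)` for the concrete `V′ = conj b (vPrimeConc …)`, with the majorants `G′(U′U) ≺ B₀c₁(1 −
θ₃₆₃c₁)⁻¹(Lʲη)²e^{−(1−α′)ρd}` = (3.42)₁ and `G′(U′U)D* ≺ B₀Λ_ρ²c₁(1 − θ_Lc₁)⁻¹Lʲη e^{−(1−3α′)ρd}` = (3.42)₃),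
`B9Ineq347AllEntries.glob347_of_342_weighted` (p27 gen 7: ONE entry of (3.42) ⇒ (3.47) with the weight (Lʲη)^γ identified for
real γ, two-space majorants; for one space = pv08's `HasMajorant` by `B6RandomWalkHom.hasMajorantHom_iff`, `Iff.rfl`),
pv08's `B6RandomWalk.Ineq260`/`Ineq261` (Lemma 2.1 of [4], typed), `B9Thm34Ext.toB6`.

WHAT THIS FILE PROVES (theorems only; 0 `def`, 0 sorry, 0 new named facts).
* `glob347_of_hasMajorant` — the one-space dictionary entry: an endomorphism `E` of the functions on ONE carrier `X` (block
  map `blk`) with a majorant `B·P(y)·e^{−δ′d(y,y′)}` obeys, for every real γ with |γ|·log L ≦ α″δ′RM and (2.60)/(2.61) at the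
  exponents α″ / 1 − α″ of δ′: |λ(x)| ≦ (L^{j′}η)^γN on Δ(y′) ⇒ |(Eλ)(v)| ≦ B·c₁(1−α″)·L^{|γ|}·P(y)·(Lʲη)^γ·N for v in the block of
  y — `glob347_of_342_weighted` at `blkX = blkY = blk`.
* **`glob347_entries13_gpExt_vPrime`** — (3.47)₁ AND (3.47)₃ for the concrete `G′(U′U)` (one theorem, a conjunction):
  under the hypotheses of `thm34_Gp_entries13_vPrime`, L ≥ 1, η > 0, a real γ, a split α″, Lemma 2.1 of [4] at the rates
  (1−α′)ρ and (1−3α′)ρ, and the located size conditions |γ|·log L ≦ α″(1−α′)ρRM, |γ|·log L ≦ α″(1−3α′)ρRM: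
  |(G′(U′U)λ)(v)| ≦ B₀c₁(ρ,α′)(1 − θ₃₆₃c₁)⁻¹·c₁((1−α′)ρ, 1−α″)·L^{|γ|}·(Lʲη)²(Lʲη)^γ·N whenever |λ|_{(γ)} ≦ N, i.e.
  |G′(U′U)λ|_{(2+γ)} ≦ B₀′(γ)|λ|_{(γ)} ((3.47)₁), and, for the right letter `D*` with the Theorem-3.1 entry `G′D* ≺ B₀Lʲη e^{−δd}`,
  |(G′(U′U)D*λ)(v)| ≦ B₀Λ_ρ²c₁(1 − θ_Lc₁)⁻¹·c₁((1−3α′)ρ, 1−α″)·L^{|γ|}·(Lʲη)(Lʲη)^γ·N ((3.47)₃).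
* `glob347_entries13_gpExt_vPrime_compact` — both at once for every γ in the printed compact set [−4, 4] under the single
  located condition 4·log L ≦ α″(1−3α′)ρRM (which implies the entry-1 condition since (1−3α′)ρ ≦ (1−α′)ρ for α′ρ ≧ 0), with
  L⁴ in place of L^{|γ|} («We define new constants in such a way that the statements of Theorem 3.1 hold for extended
  operators»).

HONEST SCOPE / NOT CLAIMED.  (i) Exactly the scope of `B9Ineq363Vprime` (its HONEST SCOPE (i)–(v) applies verbatim: Theorem 3.1
for `G′(U)` is the INPUT `h342_1/2/3/R`; the (3.19)/(3.58)/(3.24) kernel bounds of the averaging letters inside `V′` are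
hypotheses `hkQ/hkF/hsQ/hsF/hc`; finite-dimensional `𝔸` with a real basis; transports ≦ ρu; (3.37) blockwise; operator =
block-majorant form, real coordinates `S × ι`).  (ii) Only the sup-entries 1 and 3 of (3.47) (the entries `thm34_Gp_entries13_vPrime`
delivers for `G′(U′U)`); entries 2 and 4 (∇_UG′(U′U), Δ_UG′(U′U)) and the Hölder/L² statements (3.43)–(3.46) for `G′(U′U)` are NOT
here.  (iii) Constants and rates are the cell's bookkeeping, not the print's «different constants, although changes are
small»: the rate of the input majorant ((1−α′)ρ, (1−3α′)ρ) replaces δ₀ in Lemma 2.1, a further split α″ of it feeds the scale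
transfer, and the size condition |γ| log L ≦ α″·rate·RM is the located form of «for γ in a fixed compact subset» (as in
`B9Ineq347AllEntries`, HONEST (d)).  (iv) (2.60)/(2.61) of [4] at these rates are hypotheses of the printed shape (pv08's typed
forms), not proved for a geometry here.  Value = the p. 403 sentence for (3.47)₁,₃ kernel-checked for the concrete perturbation;
NOT summit progress.

RELATED IN THE TREE, NOT DUPLICATED (searched 2026-08-21: `lean search 'glob347.*gpExt|gpExt.*347'` = ∅; `B9Ineq347.glob347_entry1_of_342`
(b09) and `B9Ineq347AllEntries` (p27) are the abstract (3.42) ⇒ (3.47) steps and are USED; `B9Thm34Ext.gpExt_entry1_explicit` is the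
abstract-letter (3.42)₁ for `G′(U′U)`, superseded for the concrete `V′` by `B9Ineq363Vprime`).
-/

noncomputable section

namespace Literature.MathematicalPhysics.QuantumFieldTheory.Balaban1983to89.B9Ineq347GpExt

open Literature.MathematicalPhysics.QuantumFieldTheory.Balaban1983to89
open Literature.MathematicalPhysics.QuantumFieldTheory.Balaban1983to89.B6RandomWalk (HasMajorant Ineq260 Ineq261
  Triangle254)
open Literature.MathematicalPhysics.QuantumFieldTheory.Balaban1983to89.B6RandomWalkHom (hasMajorantHom_iff)
open Literature.MathematicalPhysics.QuantumFieldTheory.Balaban1983to89.B9Thm34Ext (toB6)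
open Literature.MathematicalPhysics.QuantumFieldTheory.Balaban1983to89.B9Ineq347 (ScaleTransfer)
open Literature.MathematicalPhysics.QuantumFieldTheory.Balaban1983to89.B9Ineq347AllEntries (glob347_of_342_weighted
  size_condition_compact)
open Literature.MathematicalPhysics.QuantumFieldTheory.Balaban1983to89.B9Eq39Adjoint (covD covDstar)
open Literature.MathematicalPhysics.QuantumFieldTheory.Balaban1983to89.B9Eq360Vprime (gPrimeExtEnd)
open Literature.MathematicalPhysics.QuantumFieldTheory.Balaban1983to89.B9Eq352DivForm (tauB)
open Literature.MathematicalPhysics.QuantumFieldTheory.Balaban1983to89.B9Eq352DivFormLetters (conj)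
open Literature.MathematicalPhysics.QuantumFieldTheory.Balaban1983to89.B9Eq352GradLetters (diffLetter)
open Literature.MathematicalPhysics.QuantumFieldTheory.Balaban1983to89.B9Eq360VprimeLetters (vPrimeConc)
open Literature.MathematicalPhysics.QuantumFieldTheory.Balaban1983to89.B9Ineq363Vprime (theta363 thetaL363
  thm34_Gp_entries13_vPrime)

/-! ## §1 The one-space dictionary entry: a majorant `B·P(y)e^{−δ′d}` ⇒ the (3.47)-type weighted global bound -/

section Generic

variable {g : B9.Geometry} [Fintype g.Site] {R : ℝ} {H : Prop} {X : Type}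

/-- «It is easy to see that the global inequalities (3.47) are consequences of the local ones (3.42) and Lemma 2.1» (p. 398),
ONE-SPACE form: an endomorphism `E` of the functions on the carrier `X` (block map `blk`) with the block majorant
`B·P(y)·e^{−δ′d(y,y′)}` satisfies, for real γ with |γ| log L ≤ α″δ′RM, Lemma 2.1 of [4] at the exponents α″ ((2.60)) and 1 − α″
((2.61)) of δ′, L ≥ 1, η > 0:  |λ(x)| ≤ (L^{j′}η)^γ·N on Δ(y′) for all y′ ⇒ |(Eλ)(v)| ≤ B·c₁(1−α″)·L^{|γ|}·P(y)·(Lʲη)^γ·N for v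
in the block of y ∈ Λ_j — i.e. |Eλ|_{(p+γ)} ≤ B(γ)|λ|_{(γ)}.  (`B9Ineq347AllEntries.glob347_of_342_weighted` with blkX = blkY;
the two-space majorant is pv08's one-space `HasMajorant` by `hasMajorantHom_iff`.)
[cite: Balaban1985BackgroundPropagators, (3.47) and the two sentences after Thm 3.1 p.398; Balaban1984PropagatorsII, Lemma 2.1 p.234] -/
theorem glob347_of_hasMajorant (blk : X → g.Site) (d : ℕ) (δ' α B γ N : ℝ) (P : g.Site → ℝ)
    (hB : 0 ≤ B) (hP : ∀ y, 0 ≤ P y) (hN : 0 ≤ N) (hL : 1 ≤ g.L) (hη : 0 < g.eta)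
    (hsize : |γ| * Real.log g.L ≤ α * δ' * R * g.M)
    (h260 : Ineq260 (toB6 g R H) δ' α) (h261 : Ineq261 d (toB6 g R H) δ' (1 - α))
    {E : Module.End ℝ (X → ℝ)}
    (hE : HasMajorant (g := toB6 g R H) blk E (fun a a' => B * P a * Real.exp (-(δ' * g.dist a a'))))
    (μ : X → ℝ) (hμ : ∀ x, |μ x| ≤ (g.len (blk x)) ^ γ * N) (v : X) :
    |E μ v| ≤ B * B6.c1 d δ' (1 - α) * g.L ^ |γ| * P (blk v) * (g.len (blk v)) ^ γ * N :=
  glob347_of_342_weighted (R := R) (H := H) blk blk d δ' α B γ N P hB hP hN hL hη hsize h260 h261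
    ((hasMajorantHom_iff (g := toB6 g R H) blk E _).2 hE) μ hμ v

/-- The same with the majorant's rate written as a product `c·ρ` inside the exponential (the shape in which
`B9Ineq363Vprime` delivers the `G′(U′U)` majorants: `e^{−((1−α′)ρ)d}`, `e^{−((1−3α′)ρ)d}`).
[cite: Balaban1985BackgroundPropagators, (3.47) and the two sentences after Thm 3.1 p.398; Balaban1984PropagatorsII, Lemma 2.1 p.234] -/
theorem glob347_of_hasMajorant' (blk : X → g.Site) (d : ℕ) (cr ρ α B γ N : ℝ) (P : g.Site → ℝ)
    (hB : 0 ≤ B) (hP : ∀ y, 0 ≤ P y) (hN : 0 ≤ N) (hL : 1 ≤ g.L) (hη : 0 < g.eta)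
    (hsize : |γ| * Real.log g.L ≤ α * (cr * ρ) * R * g.M)
    (h260 : Ineq260 (toB6 g R H) (cr * ρ) α) (h261 : Ineq261 d (toB6 g R H) (cr * ρ) (1 - α))
    {E : Module.End ℝ (X → ℝ)}
    (hE : HasMajorant (g := toB6 g R H) blk E (fun a a' => B * P a * Real.exp (-(cr * ρ * g.dist a a'))))
    (μ : X → ℝ) (hμ : ∀ x, |μ x| ≤ (g.len (blk x)) ^ γ * N) (v : X) :
    |E μ v| ≤ B * B6.c1 d (cr * ρ) (1 - α) * g.L ^ |γ| * P (blk v) * (g.len (blk v)) ^ γ * N :=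
  glob347_of_hasMajorant (R := R) (H := H) blk d (cr * ρ) α B γ N P hB hP hN hL hη hsize h260 h261 hE μ hμ v

end Generic

/-! ## §2 (3.47)₁ and (3.47)₃ for the concrete `G′(U′U)` of Theorem 3.4 -/

section Concrete

variable {𝔸 : Type*} [NormedRing 𝔸] [NormedAlgebra ℂ 𝔸] [CompleteSpace 𝔸] {ι : Type} [Fintype ι] [DecidableEq ι]
variable (b : Module.Basis ι ℝ 𝔸) {S : Type} [Fintype S] [DecidableEq S] {κ : Type} [Fintype κ]
variable (T : κ → Equiv.Perm S) (U : κ → S → 𝔸ˣ)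
variable {g : B9.Geometry} [Fintype g.Site] [DecidableEq g.Site] {Rr : ℝ} {H : Prop}

/-- **(3.47)₁ AND (3.47)₃ FOR THE CONCRETE `G′(U′U)`** (p. 403: «we can prove all the statements (3.42)–(3.47) of Theorem 3.1
for the operator G′(U′U), of course with different constants»; here the two sup-entries that `thm34_Gp_entries13_vPrime`
delivers).  Setting and hypotheses = those of `B9Ineq363Vprime.thm34_Gp_entries13_vPrime` (the concrete `V′ = conj b
(vPrimeConc …)` of (3.60), `G′(U′U) := gPrimeExtEnd G′ (V′G′)` = (3.64), Theorem 3.1 for `G′(U)` as the entries `h342_*`, the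
kernel bounds, (3.37) blockwise, transports, Lemma 2.1 of [4] at δ₀/ρ, the two smallness conditions θ₃₆₃c₁ < 1, θ_Lc₁ < 1),
PLUS, for the global step: L ≥ 1, η > 0, a real γ, a split α″ and Lemma 2.1 of [4] ((2.60) at α″, (2.61) at 1 − α″) at the two
rates (1−α′)ρ and (1−3α′)ρ of the `G′(U′U)`-majorants, with the located size conditions |γ| log L ≤ α″(1−α′)ρRM and
|γ| log L ≤ α″(1−3α′)ρRM.  Conclusion: for every λ with |λ(x)| ≤ (L^{j′}η)^γN on Δ(y′) (all y′) and every v in the block of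
y ∈ Λ_j:
  |(G′(U′U)λ)(v)| ≤ B₀c₁(ρ,α′)(1 − θ₃₆₃c₁)⁻¹ · c₁((1−α′)ρ, 1−α″) · L^{|γ|} · (Lʲη)² · (Lʲη)^γ · N   ((3.47)₁: |G′(U′U)λ|_{(2+γ)} ≤ B₀′|λ|_{(γ)}),
  |(G′(U′U)D*λ)(v)| ≤ B₀Λ_ρ²c₁(ρ,α′)(1 − θ_Lc₁)⁻¹ · c₁((1−3α′)ρ, 1−α″) · L^{|γ|} · (Lʲη) · (Lʲη)^γ · N   ((3.47)₃).
[cite: Balaban1985BackgroundPropagators, p.403 (sentence after (3.64)) + (3.47) p.398 + Thm 3.4 p.400; Balaban1984PropagatorsII, Lemma 2.1 p.234] -/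
theorem glob347_entries13_gpExt_vPrime (blk : S → g.Site) (d : ℕ) {η : ℝ} (hη : 0 < η) (A : κ → S → 𝔸)
    (kQ kF : g.Site → S → 𝔸 →L[ℝ] 𝔸) (sQ sF : S → 𝔸 →L[ℝ] 𝔸) (c w : g.Site → ℝ) (ρu d₀ M₂ C a₀ : ℝ)
    (δ₀ δ α β ρ Λ Λρ B₀ α₁ α' : ℝ)
    (hB₀ : 0 ≤ B₀) (hα₁ : 0 ≤ α₁) (hΛ : 0 ≤ Λ) (hΛρ : 0 ≤ Λρ) (hρ : 0 ≤ ρ) (hα : 0 ≤ α) (hβ : 0 ≤ β) (hδ₀ : 0 ≤ δ₀)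
    (hδ : 0 ≤ δ) (hr : ρ + (α + β) * δ₀ ≤ δ) (hα'1 : α' ≤ 1) (hα'ρ : 0 ≤ (1 - α') * ρ) (hα'ρ0 : 0 ≤ α' * ρ)
    (hα'ρ2 : 0 ≤ (1 - 2 * α') * ρ)
    (hdnn : ∀ a a' : g.Site, 0 ≤ g.dist a a') (hrefl : ∀ y : g.Site, g.dist y y = 0)
    (hsym : ∀ y y' : g.Site, g.dist y y' = g.dist y' y)
    (htri : Triangle254 (toB6 g Rr H)) (hlen : ∀ y : g.Site, 0 < g.len y)
    (h261 : Ineq261 d (toB6 g Rr H) δ₀ β) (h261' : Ineq261 d (toB6 g Rr H) ρ α')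
    (hT1 : ScaleTransfer g δ₀ α Λ (fun a => g.len a)) (hT2 : ScaleTransfer g δ₀ α Λ (fun a => g.len a ^ 2))
    (hT1i : ScaleTransfer g δ₀ α Λ (fun a => (g.len a)⁻¹)) (hT2i : ScaleTransfer g δ₀ α Λ (fun a => (g.len a ^ 2)⁻¹))
    (hTρ : ScaleTransfer g ρ α' Λρ (fun a => g.len a))
    (hM₂ : 0 ≤ M₂) (hrepr : ∀ (v : 𝔸) (i : ι), |b.repr v i| ≤ M₂ * ‖v‖)
    (hsmall : ∀ y : g.Site, η * (α₁ * (g.len y)⁻¹) ≤ 1 / 4)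
    (hA : ∀ μ x, ‖A μ x‖ ≤ α₁ * (g.len (blk x))⁻¹ ∧ ‖tauB T U μ (A μ) x‖ ≤ α₁ * (g.len (blk x))⁻¹)
    (h337s : ∀ μ x, ‖((η : ℂ)⁻¹) • covDstar T U μ (A μ) x‖ ≤ α₁ * (g.len (blk x) ^ 2)⁻¹)
    (h337F : ∀ μ x, ‖((η : ℂ)⁻¹) • covD T U μ (A μ) x‖ ≤ α₁ * (g.len (blk x) ^ 2)⁻¹)
    (h337B : ∀ μ x, ‖((η : ℂ)⁻¹) • covDstar T U μ (tauB T U μ (A μ)) x‖ ≤ α₁ * (g.len (blk x) ^ 2)⁻¹)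
    (hρu : ∀ μ x, ‖((U μ x : 𝔸ˣ) : 𝔸)‖ ≤ ρu ∧ ‖(((U μ x)⁻¹ : 𝔸ˣ) : 𝔸)‖ ≤ ρu)
    (hd₀ : ∀ μ x, g.dist (blk x) (blk (T μ x)) ≤ d₀ ∧ g.dist (blk x) (blk ((T μ).symm x)) ≤ d₀)
    (hd₀0 : ∀ y : g.Site, g.dist y y ≤ d₀)
    (hw : ∀ y, 0 ≤ w y) (hcard : ∀ y, ((B9Eq360Vprime.block blk y).card : ℝ) * w y ≤ 1) (hC : 0 ≤ C) (ha₀ : 0 ≤ a₀)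
    (hkQ : ∀ y x, blk x = y → ‖kQ y x‖ ≤ w y) (hkF : ∀ y x, blk x = y → ‖kF y x‖ ≤ C * α₁ * w y)
    (hsQ : ∀ x, ‖sQ x‖ ≤ 1) (hsF : ∀ x, ‖sF x‖ ≤ C * α₁) (hc : ∀ y, |c y| ≤ a₀ * (g.len y ^ 2)⁻¹)
    (hθ : theta363 (Fintype.card κ) ρu α₁ a₀ C M₂ (∑ i, ‖b i‖) (Real.exp (δ * d₀)) B₀ Λ (B6.c1 d δ₀ β) *
      B6.c1 d ρ α' < 1)
    (hθL : thetaL363 (Fintype.card κ) ρu α₁ a₀ C M₂ (∑ i, ‖b i‖) (Real.exp (δ * d₀)) B₀ Λ (B6.c1 d δ₀ β) *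
      B6.c1 d ρ α' < 1)
    (Δp Gp : Module.End ℝ (S × ι → ℝ)) (hΔG : Δp * Gp = 1) (hGΔ : Gp * Δp = 1) {Ds : Module.End ℝ (S × ι → ℝ)}
    (h342_1 : HasMajorant (g := toB6 g Rr H) (fun p : S × ι => blk p.1) Gp
      (fun a a' => B₀ * g.len a ^ 2 * Real.exp (-(δ * g.dist a a'))))
    (h342_2 : ∀ k : κ ⊕ κ, HasMajorant (g := toB6 g Rr H) (fun p : S × ι => blk p.1)
      (conj b (diffLetter T U ((η : ℂ)⁻¹) k) * Gp) (fun a a' => B₀ * g.len a * Real.exp (-(δ * g.dist a a'))))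
    (h342_3 : ∀ k : κ ⊕ κ, HasMajorant (g := toB6 g Rr H) (fun p : S × ι => blk p.1)
      (Gp * conj b (diffLetter T U ((η : ℂ)⁻¹) k)) (fun a a' => B₀ * g.len a * Real.exp (-(δ * g.dist a a'))))
    (h342R : HasMajorant (g := toB6 g Rr H) (fun p : S × ι => blk p.1) (Gp * Ds)
      (fun a a' => B₀ * g.len a * Real.exp (-(δ * g.dist a a'))))
    -- the global step: L ≥ 1, η > 0, the weight exponent γ, the split α″ and Lemma 2.1 of [4] at the two rates
    (hL : 1 ≤ g.L) (hgeta : 0 < g.eta) (γ α'' : ℝ)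
    (hsize1 : |γ| * Real.log g.L ≤ α'' * ((1 - α') * ρ) * Rr * g.M)
    (hsize3 : |γ| * Real.log g.L ≤ α'' * ((1 - 3 * α') * ρ) * Rr * g.M)
    (h260a : Ineq260 (toB6 g Rr H) ((1 - α') * ρ) α'') (h261a : Ineq261 d (toB6 g Rr H) ((1 - α') * ρ) (1 - α''))
    (h260b : Ineq260 (toB6 g Rr H) ((1 - 3 * α') * ρ) α'')
    (h261b : Ineq261 d (toB6 g Rr H) ((1 - 3 * α') * ρ) (1 - α''))
    (N : ℝ) (hN : 0 ≤ N) (μ : S × ι → ℝ) (hμ : ∀ p, |μ p| ≤ (g.len (blk p.1)) ^ γ * N) (v : S × ι) :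
    let V := conj b (vPrimeConc T U η A blk kQ kF sQ sF c)
    let GpExt := gPrimeExtEnd Gp (V * Gp)
    |GpExt μ v| ≤ B₀ * B6.c1 d ρ α'
          * (1 - theta363 (Fintype.card κ) ρu α₁ a₀ C M₂ (∑ i, ‖b i‖) (Real.exp (δ * d₀)) B₀ Λ (B6.c1 d δ₀ β)
              * B6.c1 d ρ α')⁻¹
          * B6.c1 d ((1 - α') * ρ) (1 - α'') * g.L ^ |γ| * g.len (blk v.1) ^ 2 * (g.len (blk v.1)) ^ γ * N
      ∧ |(GpExt * Ds) μ v| ≤ B₀ * Λρ ^ 2 * B6.c1 d ρ α'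
          * (1 - thetaL363 (Fintype.card κ) ρu α₁ a₀ C M₂ (∑ i, ‖b i‖) (Real.exp (δ * d₀)) B₀ Λ (B6.c1 d δ₀ β)
              * B6.c1 d ρ α')⁻¹
          * B6.c1 d ((1 - 3 * α') * ρ) (1 - α'') * g.L ^ |γ| * g.len (blk v.1) * (g.len (blk v.1)) ^ γ * N := by
  intro V GpExt
  obtain ⟨-, -, hE1, hE3⟩ := thm34_Gp_entries13_vPrime b T U blk d hη A kQ kF sQ sF c w ρu d₀ M₂ C a₀ δ₀ δ α β ρ Λ Λρ
    B₀ α₁ α' hB₀ hα₁ hΛ hΛρ hρ hα hβ hδ₀ hδ hr hα'1 hα'ρ hα'ρ0 hα'ρ2 hdnn hrefl hsym htri hlen h261 h261' hT1 hT2 hT1i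
    hT2i hTρ hM₂ hrepr hsmall hA h337s h337F h337B hρu hd₀ hd₀0 hw hcard hC ha₀ hkQ hkF hsQ hsF hc hθ hθL Δp Gp hΔG hGΔ
    (Ds := Ds) h342_1 h342_2 h342_3 h342R
  have hSb : 0 ≤ ∑ i, ‖b i‖ := Finset.sum_nonneg fun i _ => norm_nonneg _
  have hc1ρ : 0 ≤ B6.c1 d ρ α' := B6RandomWalk.c1_nonneg d ρ α'
  have hθ0 : 0 ≤ theta363 (Fintype.card κ) ρu α₁ a₀ C M₂ (∑ i, ‖b i‖) (Real.exp (δ * d₀)) B₀ Λ (B6.c1 d δ₀ β) :=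
    B9Ineq363Vprime.theta363_nonneg hα₁ ha₀ hC hM₂ hSb (Real.exp_nonneg _) hB₀ hΛ (B6RandomWalk.c1_nonneg d δ₀ β)
  have hθL0 : 0 ≤ thetaL363 (Fintype.card κ) ρu α₁ a₀ C M₂ (∑ i, ‖b i‖) (Real.exp (δ * d₀)) B₀ Λ (B6.c1 d δ₀ β) :=
    B9Ineq363Vprime.thetaL363_nonneg hα₁ ha₀ hC hM₂ hSb (Real.exp_nonneg _) hB₀ hΛ (B6RandomWalk.c1_nonneg d δ₀ β)
  have hB1 : 0 ≤ B₀ * B6.c1 d ρ α'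
      * (1 - theta363 (Fintype.card κ) ρu α₁ a₀ C M₂ (∑ i, ‖b i‖) (Real.exp (δ * d₀)) B₀ Λ (B6.c1 d δ₀ β)
          * B6.c1 d ρ α')⁻¹ :=
    mul_nonneg (mul_nonneg hB₀ hc1ρ) (inv_nonneg.2 (sub_nonneg.2 hθ.le))
  have hB3 : 0 ≤ B₀ * Λρ ^ 2 * B6.c1 d ρ α'
      * (1 - thetaL363 (Fintype.card κ) ρu α₁ a₀ C M₂ (∑ i, ‖b i‖) (Real.exp (δ * d₀)) B₀ Λ (B6.c1 d δ₀ β)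
          * B6.c1 d ρ α')⁻¹ :=
    mul_nonneg (mul_nonneg (mul_nonneg hB₀ (sq_nonneg _)) hc1ρ) (inv_nonneg.2 (sub_nonneg.2 hθL.le))
  refine ⟨?_, ?_⟩
  · exact glob347_of_hasMajorant (R := Rr) (H := H) (fun p : S × ι => blk p.1) d ((1 - α') * ρ) α'' _ γ N
      (fun a => g.len a ^ 2) hB1 (fun y => sq_nonneg _) hN hL hgeta hsize1 h260a h261a hE1 μ hμ v
  · exact glob347_of_hasMajorant (R := Rr) (H := H) (fun p : S × ι => blk p.1) d ((1 - 3 * α') * ρ) α'' _ γ N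
      (fun a => g.len a) hB3 (fun y => (hlen y).le) hN hL hgeta hsize3 h260b h261b hE3 μ hμ v

/-- **The printed compact set.**  Both entries for EVERY γ ∈ [−4, 4] under the single located size condition
4·log L ≤ α″(1−3α′)ρRM (it implies the entry-1 condition because (1−3α′)ρ ≤ (1−α′)ρ when α′ρ ≥ 0 and α″RM ≥ 0), with the
γ-uniform factor L⁴ («for γ in a fixed compact subset of real numbers, e.g. for γ ∈ [−4, 4]», p. 398; «We define new constants in
such a way that the statements of Theorem 3.1 hold for extended operators», p. 403).
[cite: Balaban1985BackgroundPropagators, (3.47) p.398 + p.403] -/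
theorem glob347_entries13_gpExt_vPrime_compact (blk : S → g.Site) (d : ℕ) {η : ℝ} (hη : 0 < η) (A : κ → S → 𝔸)
    (kQ kF : g.Site → S → 𝔸 →L[ℝ] 𝔸) (sQ sF : S → 𝔸 →L[ℝ] 𝔸) (c w : g.Site → ℝ) (ρu d₀ M₂ C a₀ : ℝ)
    (δ₀ δ α β ρ Λ Λρ B₀ α₁ α' : ℝ)
    (hB₀ : 0 ≤ B₀) (hα₁ : 0 ≤ α₁) (hΛ : 0 ≤ Λ) (hΛρ : 0 ≤ Λρ) (hρ : 0 ≤ ρ) (hα : 0 ≤ α) (hβ : 0 ≤ β) (hδ₀ : 0 ≤ δ₀)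
    (hδ : 0 ≤ δ) (hr : ρ + (α + β) * δ₀ ≤ δ) (hα'1 : α' ≤ 1) (hα'ρ : 0 ≤ (1 - α') * ρ) (hα'ρ0 : 0 ≤ α' * ρ)
    (hα'ρ2 : 0 ≤ (1 - 2 * α') * ρ)
    (hdnn : ∀ a a' : g.Site, 0 ≤ g.dist a a') (hrefl : ∀ y : g.Site, g.dist y y = 0)
    (hsym : ∀ y y' : g.Site, g.dist y y' = g.dist y' y)
    (htri : Triangle254 (toB6 g Rr H)) (hlen : ∀ y : g.Site, 0 < g.len y)
    (h261 : Ineq261 d (toB6 g Rr H) δ₀ β) (h261' : Ineq261 d (toB6 g Rr H) ρ α')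
    (hT1 : ScaleTransfer g δ₀ α Λ (fun a => g.len a)) (hT2 : ScaleTransfer g δ₀ α Λ (fun a => g.len a ^ 2))
    (hT1i : ScaleTransfer g δ₀ α Λ (fun a => (g.len a)⁻¹)) (hT2i : ScaleTransfer g δ₀ α Λ (fun a => (g.len a ^ 2)⁻¹))
    (hTρ : ScaleTransfer g ρ α' Λρ (fun a => g.len a))
    (hM₂ : 0 ≤ M₂) (hrepr : ∀ (v : 𝔸) (i : ι), |b.repr v i| ≤ M₂ * ‖v‖)
    (hsmall : ∀ y : g.Site, η * (α₁ * (g.len y)⁻¹) ≤ 1 / 4)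
    (hA : ∀ μ x, ‖A μ x‖ ≤ α₁ * (g.len (blk x))⁻¹ ∧ ‖tauB T U μ (A μ) x‖ ≤ α₁ * (g.len (blk x))⁻¹)
    (h337s : ∀ μ x, ‖((η : ℂ)⁻¹) • covDstar T U μ (A μ) x‖ ≤ α₁ * (g.len (blk x) ^ 2)⁻¹)
    (h337F : ∀ μ x, ‖((η : ℂ)⁻¹) • covD T U μ (A μ) x‖ ≤ α₁ * (g.len (blk x) ^ 2)⁻¹)
    (h337B : ∀ μ x, ‖((η : ℂ)⁻¹) • covDstar T U μ (tauB T U μ (A μ)) x‖ ≤ α₁ * (g.len (blk x) ^ 2)⁻¹)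
    (hρu : ∀ μ x, ‖((U μ x : 𝔸ˣ) : 𝔸)‖ ≤ ρu ∧ ‖(((U μ x)⁻¹ : 𝔸ˣ) : 𝔸)‖ ≤ ρu)
    (hd₀ : ∀ μ x, g.dist (blk x) (blk (T μ x)) ≤ d₀ ∧ g.dist (blk x) (blk ((T μ).symm x)) ≤ d₀)
    (hd₀0 : ∀ y : g.Site, g.dist y y ≤ d₀)
    (hw : ∀ y, 0 ≤ w y) (hcard : ∀ y, ((B9Eq360Vprime.block blk y).card : ℝ) * w y ≤ 1) (hC : 0 ≤ C) (ha₀ : 0 ≤ a₀)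
    (hkQ : ∀ y x, blk x = y → ‖kQ y x‖ ≤ w y) (hkF : ∀ y x, blk x = y → ‖kF y x‖ ≤ C * α₁ * w y)
    (hsQ : ∀ x, ‖sQ x‖ ≤ 1) (hsF : ∀ x, ‖sF x‖ ≤ C * α₁) (hc : ∀ y, |c y| ≤ a₀ * (g.len y ^ 2)⁻¹)
    (hθ : theta363 (Fintype.card κ) ρu α₁ a₀ C M₂ (∑ i, ‖b i‖) (Real.exp (δ * d₀)) B₀ Λ (B6.c1 d δ₀ β) *
      B6.c1 d ρ α' < 1)
    (hθL : thetaL363 (Fintype.card κ) ρu α₁ a₀ C M₂ (∑ i, ‖b i‖) (Real.exp (δ * d₀)) B₀ Λ (B6.c1 d δ₀ β) *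
      B6.c1 d ρ α' < 1)
    (Δp Gp : Module.End ℝ (S × ι → ℝ)) (hΔG : Δp * Gp = 1) (hGΔ : Gp * Δp = 1) {Ds : Module.End ℝ (S × ι → ℝ)}
    (h342_1 : HasMajorant (g := toB6 g Rr H) (fun p : S × ι => blk p.1) Gp
      (fun a a' => B₀ * g.len a ^ 2 * Real.exp (-(δ * g.dist a a'))))
    (h342_2 : ∀ k : κ ⊕ κ, HasMajorant (g := toB6 g Rr H) (fun p : S × ι => blk p.1)
      (conj b (diffLetter T U ((η : ℂ)⁻¹) k) * Gp) (fun a a' => B₀ * g.len a * Real.exp (-(δ * g.dist a a'))))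
    (h342_3 : ∀ k : κ ⊕ κ, HasMajorant (g := toB6 g Rr H) (fun p : S × ι => blk p.1)
      (Gp * conj b (diffLetter T U ((η : ℂ)⁻¹) k)) (fun a a' => B₀ * g.len a * Real.exp (-(δ * g.dist a a'))))
    (h342R : HasMajorant (g := toB6 g Rr H) (fun p : S × ι => blk p.1) (Gp * Ds)
      (fun a a' => B₀ * g.len a * Real.exp (-(δ * g.dist a a'))))
    (hL : 1 ≤ g.L) (hgeta : 0 < g.eta) (α'' : ℝ) (hα''RM : 0 ≤ α'' * Rr * g.M)
    (hsize : 4 * Real.log g.L ≤ α'' * ((1 - 3 * α') * ρ) * Rr * g.M)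
    (h260a : Ineq260 (toB6 g Rr H) ((1 - α') * ρ) α'') (h261a : Ineq261 d (toB6 g Rr H) ((1 - α') * ρ) (1 - α''))
    (h260b : Ineq260 (toB6 g Rr H) ((1 - 3 * α') * ρ) α'')
    (h261b : Ineq261 d (toB6 g Rr H) ((1 - 3 * α') * ρ) (1 - α''))
    (γ : ℝ) (hγ : |γ| ≤ 4) (N : ℝ) (hN : 0 ≤ N) (μ : S × ι → ℝ) (hμ : ∀ p, |μ p| ≤ (g.len (blk p.1)) ^ γ * N)
    (v : S × ι) :
    let V := conj b (vPrimeConc T U η A blk kQ kF sQ sF c)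
    let GpExt := gPrimeExtEnd Gp (V * Gp)
    |GpExt μ v| ≤ B₀ * B6.c1 d ρ α'
          * (1 - theta363 (Fintype.card κ) ρu α₁ a₀ C M₂ (∑ i, ‖b i‖) (Real.exp (δ * d₀)) B₀ Λ (B6.c1 d δ₀ β)
              * B6.c1 d ρ α')⁻¹
          * B6.c1 d ((1 - α') * ρ) (1 - α'') * g.L ^ (4 : ℝ) * g.len (blk v.1) ^ 2 * (g.len (blk v.1)) ^ γ * N
      ∧ |(GpExt * Ds) μ v| ≤ B₀ * Λρ ^ 2 * B6.c1 d ρ α'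
          * (1 - thetaL363 (Fintype.card κ) ρu α₁ a₀ C M₂ (∑ i, ‖b i‖) (Real.exp (δ * d₀)) B₀ Λ (B6.c1 d δ₀ β)
              * B6.c1 d ρ α')⁻¹
          * B6.c1 d ((1 - 3 * α') * ρ) (1 - α'') * g.L ^ (4 : ℝ) * g.len (blk v.1) * (g.len (blk v.1)) ^ γ * N := by
  intro V GpExt
  -- the entry-3 size condition implies the entry-1 size condition: (1−3α′)ρ ≤ (1−α′)ρ
  have hrate : α'' * ((1 - 3 * α') * ρ) * Rr * g.M ≤ α'' * ((1 - α') * ρ) * Rr * g.M := by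
    have h1 : (1 - 3 * α') * ρ ≤ (1 - α') * ρ := by nlinarith
    have : α'' * ((1 - 3 * α') * ρ) * Rr * g.M = ((1 - 3 * α') * ρ) * (α'' * Rr * g.M) := by ring
    rw [this, show α'' * ((1 - α') * ρ) * Rr * g.M = ((1 - α') * ρ) * (α'' * Rr * g.M) by ring]
    exact mul_le_mul_of_nonneg_right h1 hα''RM
  obtain ⟨hsz3, hL4⟩ := size_condition_compact g.L γ _ hL hγ hsize
  have hsz1 : |γ| * Real.log g.L ≤ α'' * ((1 - α') * ρ) * Rr * g.M := hsz3.trans hrate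
  obtain ⟨h1, h3⟩ := glob347_entries13_gpExt_vPrime b T U blk d hη A kQ kF sQ sF c w ρu d₀ M₂ C a₀ δ₀ δ α β ρ Λ Λρ
    B₀ α₁ α' hB₀ hα₁ hΛ hΛρ hρ hα hβ hδ₀ hδ hr hα'1 hα'ρ hα'ρ0 hα'ρ2 hdnn hrefl hsym htri hlen h261 h261' hT1 hT2 hT1i
    hT2i hTρ hM₂ hrepr hsmall hA h337s h337F h337B hρu hd₀ hd₀0 hw hcard hC ha₀ hkQ hkF hsQ hsF hc hθ hθL Δp Gp hΔG hGΔ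
    (Ds := Ds) h342_1 h342_2 h342_3 h342R hL hgeta γ α'' hsz1 hsz3 h260a h261a h260b h261b N hN μ hμ v
  have hSb : 0 ≤ ∑ i, ‖b i‖ := Finset.sum_nonneg fun i _ => norm_nonneg _
  have hc1ρ : 0 ≤ B6.c1 d ρ α' := B6RandomWalk.c1_nonneg d ρ α'
  have hB1 : 0 ≤ B₀ * B6.c1 d ρ α'
      * (1 - theta363 (Fintype.card κ) ρu α₁ a₀ C M₂ (∑ i, ‖b i‖) (Real.exp (δ * d₀)) B₀ Λ (B6.c1 d δ₀ β)
          * B6.c1 d ρ α')⁻¹ * B6.c1 d ((1 - α') * ρ) (1 - α'') :=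
    mul_nonneg (mul_nonneg (mul_nonneg hB₀ hc1ρ) (inv_nonneg.2 (sub_nonneg.2 hθ.le))) (B6RandomWalk.c1_nonneg _ _ _)
  have hB3 : 0 ≤ B₀ * Λρ ^ 2 * B6.c1 d ρ α'
      * (1 - thetaL363 (Fintype.card κ) ρu α₁ a₀ C M₂ (∑ i, ‖b i‖) (Real.exp (δ * d₀)) B₀ Λ (B6.c1 d δ₀ β)
          * B6.c1 d ρ α')⁻¹ * B6.c1 d ((1 - 3 * α') * ρ) (1 - α'') :=
    mul_nonneg (mul_nonneg (mul_nonneg (mul_nonneg hB₀ (sq_nonneg _)) hc1ρ) (inv_nonneg.2 (sub_nonneg.2 hθL.le)))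
      (B6RandomWalk.c1_nonneg _ _ _)
  have hL0 : 0 < g.L := lt_of_lt_of_le one_pos hL
  have hw1 : 0 ≤ g.len (blk v.1) ^ 2 * (g.len (blk v.1)) ^ γ * N :=
    mul_nonneg (mul_nonneg (sq_nonneg _) (Real.rpow_nonneg (hlen _).le _)) hN
  have hw3 : 0 ≤ g.len (blk v.1) * (g.len (blk v.1)) ^ γ * N :=
    mul_nonneg (mul_nonneg (hlen _).le (Real.rpow_nonneg (hlen _).le _)) hN
  refine ⟨h1.trans ?_, h3.trans ?_⟩
  · have := mul_le_mul_of_nonneg_left (mul_le_mul_of_nonneg_right hL4 hw1) hB1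
    calc _ = B₀ * B6.c1 d ρ α'
          * (1 - theta363 (Fintype.card κ) ρu α₁ a₀ C M₂ (∑ i, ‖b i‖) (Real.exp (δ * d₀)) B₀ Λ (B6.c1 d δ₀ β)
              * B6.c1 d ρ α')⁻¹ * B6.c1 d ((1 - α') * ρ) (1 - α'')
          * (g.L ^ |γ| * (g.len (blk v.1) ^ 2 * (g.len (blk v.1)) ^ γ * N)) := by ring
      _ ≤ B₀ * B6.c1 d ρ α'
          * (1 - theta363 (Fintype.card κ) ρu α₁ a₀ C M₂ (∑ i, ‖b i‖) (Real.exp (δ * d₀)) B₀ Λ (B6.c1 d δ₀ β)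
              * B6.c1 d ρ α')⁻¹ * B6.c1 d ((1 - α') * ρ) (1 - α'')
          * (g.L ^ (4 : ℝ) * (g.len (blk v.1) ^ 2 * (g.len (blk v.1)) ^ γ * N)) := this
      _ = _ := by ring
  · have := mul_le_mul_of_nonneg_left (mul_le_mul_of_nonneg_right hL4 hw3) hB3
    calc _ = B₀ * Λρ ^ 2 * B6.c1 d ρ α'
          * (1 - thetaL363 (Fintype.card κ) ρu α₁ a₀ C M₂ (∑ i, ‖b i‖) (Real.exp (δ * d₀)) B₀ Λ (B6.c1 d δ₀ β)
              * B6.c1 d ρ α')⁻¹ * B6.c1 d ((1 - 3 * α') * ρ) (1 - α'')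
          * (g.L ^ |γ| * (g.len (blk v.1) * (g.len (blk v.1)) ^ γ * N)) := by ring
      _ ≤ B₀ * Λρ ^ 2 * B6.c1 d ρ α'
          * (1 - thetaL363 (Fintype.card κ) ρu α₁ a₀ C M₂ (∑ i, ‖b i‖) (Real.exp (δ * d₀)) B₀ Λ (B6.c1 d δ₀ β)
              * B6.c1 d ρ α')⁻¹ * B6.c1 d ((1 - 3 * α') * ρ) (1 - α'')
          * (g.L ^ (4 : ℝ) * (g.len (blk v.1) * (g.len (blk v.1)) ^ γ * N)) := this
      _ = _ := by ring

end Concrete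

end Literature.MathematicalPhysics.QuantumFieldTheory.Balaban1983to89.B9Ineq347GpExt
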